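import Mathlib
import Literature.NumberTheory.Irrationality.Fischler2002.KLSequenceAlgebraProofs
import HarnessLib

/-!
# Fischler 2002, Théorème 2.1: `𝒦(p) = 𝓛(P)` PROVED for every `n ≥ 2`

Topic `Literature/NumberTheory/Irrationality/Fischler2002`; proofs-only companion of `BeukersSorokinChangeOfVariables.lean`, whose
NAMED FACT `theoreme21` is DISCHARGED here as `theoreme21_holds` (third file: the substitution theorem is in
`KLSubstitutionProofs.lean`, the finite-product algebra in `KLSequenceAlgebraProofs.lean`). Cell `pub-zeta5`, seat ct-1 g30,
2026-08-27. Source: S. Fischler, « Formes linéaires en polyzêtas et intégrales multiples », C. R. Acad. Sci. Paris Sér. I **335**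
(2002) 1–4 = arXiv:math/0202064 [Fischler2002Polyzetas], §2 Théorème 2.1: "Pour tout `p ∈ ℤ^{3n−1}` on a `𝒦(p) = 𝓛(P)`" with
`A_k = a_{n+1−k}`, `B_k = b_{n+1−k}` (`k ≥ 2`), `B₁ = a_{n−1} + b_n − c₂ − ⋯ − c_n`, `C_k = a_{n+1−k} + b_{n+1−k} − c_k − ⋯ − c_n`
(`k` even), `C_k = c_k + ⋯ + c_n − a_{n−k}` (`k` odd, `a₀ = 0`); "Ce résultat provient du changement de variables défini par
`x_k = X_{n+1−k}` pour `k ≡ n mod 2` et `x_k = (1 − X₁…X_{n−k})X_{n+1−k}/(1 − X₁…X_{n+1−k})` pour `k ≢ n mod 2`"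
(journal version [Fischler2003RhinViola], §5).

HONEST FRAMING (cells pub-zeta5 / zeta5-irr): systematic search; no irrationality claim unless certified. An identity between
(possibly infinite) `n`-fold integrals of non-negative functions; not an irrationality statement; nothing about `ζ(5)`.

## The proof
`𝒦(p) = ∫⁻_{(0,1)^n} F_𝒦(x) dx = ∫⁻ F_𝒦(y ∘ rev) dy` (`KL.lintegral_cube_rev`) `= ∫⁻ F_𝒦(Y(X) ∘ rev) · W(X) dX`
(`KL.lintegral_cube_eq_lintegral_moebius`), and POINTWISE on the open cube `F_𝒦(Y(X) ∘ rev) · W(X) = F_𝓛(P)(X)`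
(`integrandK_subst`): the coordinates of `x = Y(X) ∘ rev` are `x_k = y_{n+1−k}` (`JnPsi.coord_rev`) with `y_j = X_j` (`j` odd),
`(1−Π_{j−1})X_j/(1−Π_j)` (`j` even) (`coord_moebiusMap`); Fischler's `δ̃_k(x) = Σ_{j≤k}(−1)^j y₁⋯y_j` becomes
`∏_{i≤k}(1−Π_i)^{ε_i}` (`KL.altSum_closed_form`); the numerator becomes `∏ X_j^{A_j}(1−X_j)^{b_{n+1−j}}` times powers of the
`1 − Π_i` (`KL.numerator_subst`), the `δ̃_k^{c_k}` become `∏ (1−Π_i)^{ε_iΣ_{k≥max(i,2)}c_k}` (`KL.prod_closedForm_zpow`), the parity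
products times the Jacobian give `∏_{k≥2}(1−Π_k)^{−1}` (`KL.parity_jacobian`), and the remaining exponents of `1 − Π_i` are exactly
`B₁ − b_n` (`i = 1`) and `−C_i` (`i ≥ 2`) (`exponent_identity`). Theorems only; no definition; no new named fact (net debt −1).
-/

noncomputable section

namespace Literature.NumberTheory.Irrationality.Fischler2002

open MeasureTheory Set Finset
open scoped ENNReal

namespace KL

open JnChi JnPsi

/-! ### Coordinates of the substituted point -/

/-- The 1-based coordinates of `Y(X)`: `y_j = X_j` (`j` odd), `y_j = (1−Π_{j−1})X_j/(1−Π_j)` (`j` even).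
[cite: Fischler2002Polyzetas, §2 Théorème 2.1 (changement de variables)] -/
theorem coord_moebiusMap {n : ℕ} (X : Fin n → ℝ) (j : ℕ) :
    coord (fun i : Fin n => if Even (i.1 + 1) then (1 - headProduct X i.1) * X i / (1 - headProduct X (i.1 + 1)) else X i) j =
      (if Even j then (1 - headProduct X (j - 1)) / (1 - headProduct X j) else 1) * coord X j := by
  unfold coord
  by_cases hj : 1 ≤ j ∧ j ≤ n
  · rw [dif_pos hj, dif_pos hj]
    dsimp only
    rw [Nat.sub_add_cancel hj.1]
    by_cases hje : Even j
    · rw [if_pos hje, if_pos hje]; ring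
    · rw [if_neg hje, if_neg hje, one_mul]
  · rw [dif_neg hj, dif_neg hj, mul_zero]

/-- `Π_j(X) = 0` for `j > n` (the coordinate `X_j` is `0` there). [cite: Fischler2002Polyzetas, §2 p. 2 (definition of 𝓛(P))] -/
theorem headProduct_eq_zero_of_lt {n : ℕ} (X : Fin n → ℝ) {j : ℕ} (hj : n < j) : headProduct X j = 0 := by
  unfold headProduct
  refine Finset.prod_eq_zero (Finset.mem_Icc.2 ⟨by omega, le_rfl⟩) ?_
  unfold coord
  rw [dif_neg (by omega)]

/-- On the open cube `1 − Π_j(X) ≠ 0` for every `j ≥ 1`. [cite: Fischler2002Polyzetas, §2 p. 2 (definition of 𝓛(P))] -/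
theorem one_sub_headProduct_ne_zero {n : ℕ} {X : Fin n → ℝ} (hX : ∀ i, 0 < X i ∧ X i < 1) (j : ℕ) (hj : 1 ≤ j) :
    1 - headProduct X j ≠ 0 := by
  rcases le_or_gt j n with h | h
  · exact ne_of_gt (by linarith [(headProduct_mem hX j h).2.2 hj])
  · rw [headProduct_eq_zero_of_lt X h]; norm_num

/-- **`δ̃_k` of the substituted point**: if `y_j = X_j` (`j` odd), `(1−Π_{j−1})X_j/(1−Π_j)` (`j` even) and `x = y ∘ rev`
(so `x_{n−i} = y_{i+1}`), then for `k ≤ n`, `δ̃_k(x) = ∏_{i≤k} (1 − Π_i(X))^{ε_i}`.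
[cite: Fischler2002Polyzetas, §2 Théorème 2.1 and p. 2 (definition of δ̃_k)] -/
theorem deltaTilde_subst {n : ℕ} {X Y : Fin n → ℝ} (hX : ∀ i, 0 < X i ∧ X i < 1)
    (hy : ∀ j, 1 ≤ j → j ≤ n →
      coord Y j = (if Even j then (1 - headProduct X (j - 1)) / (1 - headProduct X j) else 1) * coord X j)
    {k : ℕ} (hk : k ≤ n) :
    deltaTilde (fun t : Fin n => Y (Fin.rev t)) k =
      ∏ i ∈ Finset.Icc 1 k, (1 - headProduct X i) ^ (if Even i then (-1 : ℤ) else 1) := by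
  unfold deltaTilde
  rw [Finset.sum_congr rfl fun j hj => by
    rw [Finset.prod_congr rfl fun i hi => by
      rw [coord_rev Y (n - i), show n + 1 - (n - i) = i + 1 by
        have := Finset.mem_range.1 hi; have := Finset.mem_range.1 hj; omega]]]
  exact altSum_closed_form (coord X) (coord Y) (headProduct X) n (headProduct_zero X) (headProduct_succ X)
    (one_sub_headProduct_ne_zero hX) hy k hk

/-! ### The exponents of `1 − X₁⋯X_i`: Fischler's `B₁` and `C_k` -/

/-- **The exponent bookkeeping is the printed `P = (A, B, C)`**: for `1 ≤ i ≤ n` (`n ≥ 2`), the total exponent of `1 − Π_i`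
produced by the numerator and the `δ̃_k^{c_k}`, namely `[i+1 even, ≤ n]a_{n−i} − [i even](a_{n+1−i} + b_{n+1−i}) − ε_iΣ_{k≥max(i,2)} c_k`,
equals `B₁ − b_n` for `i = 1` and `−C_i` for `i ≥ 2`. [cite: Fischler2002Polyzetas, §2 Théorème 2.1 (formules pour B₁, C_k)] -/
theorem exponent_identity {n : ℕ} (hn : 2 ≤ n) (p : Exponents) {i : ℕ} (hi : i ∈ Finset.Icc 1 n) :
    ((if Even (i + 1) ∧ i + 1 ≤ n then p.a (n + 1 - (i + 1)) else 0) -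
        (if Even i then p.a (n + 1 - i) + p.b (n + 1 - i) else 0) -
        (if Even i then (-1 : ℤ) else 1) * ∑ k ∈ Finset.Icc (max i 2) n, p.c k : ℤ) =
      if i = 1 then (paramMap n p).b 1 - p.b (n + 1 - 1) else -((paramMap n p).c i) := by
  rw [Finset.mem_Icc] at hi
  by_cases h1 : i = 1
  · subst h1
    have e1 : n + 1 - (1 + 1) = n - 1 := by omega
    have e2 : n + 1 - 1 = n := by omega
    simp only [show Even (1 + 1) from ⟨1, rfl⟩, show (1 + 1 ≤ n) from by omega, and_self, if_true, Nat.not_even_one,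
      if_false, e1, e2, show max 1 2 = 2 from rfl, paramMap]
    ring
  · rw [if_neg h1, show max i 2 = i from max_eq_left (by omega)]
    simp only [paramMap]
    by_cases hie : Even i
    · have hio : ¬ Even (i + 1) := Nat.not_even_iff_odd.mpr (Even.add_one hie)
      simp only [hie, hio, false_and, if_true, if_false]
      ring
    · have hio : Even (i + 1) := Odd.add_one (Nat.not_even_iff_odd.mp hie)
      simp only [hie, hio, true_and, if_false]
      by_cases hin : i = n
      · subst hin
        simp only [show ¬ (i + 1 ≤ i) from by omega, if_false, if_true]
        ring
      · rw [if_pos (by omega : i + 1 ≤ n), if_neg hin, show n + 1 - (i + 1) = n - i by omega]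
        ring

/-! ### Measurability of the integrand of `𝒦(p)` -/

/-- `δ̃_k` is a measurable function of `x`. [cite: Fischler2002Polyzetas, §2 p. 2 (definition of δ̃_k)] -/
theorem measurable_deltaTilde {n : ℕ} (k : ℕ) : Measurable fun x : Fin n → ℝ => deltaTilde x k := by
  unfold deltaTilde
  refine Finset.measurable_sum _ fun j _ => ?_
  exact measurable_const.mul (Finset.measurable_prod _ fun i _ => measurable_coord _)

/-- The integrand of `𝒦(p)` is measurable. [cite: Fischler2002Polyzetas, §2 p. 2 (definition of 𝒦(p))] -/
theorem measurable_integrandK (n : ℕ) (p : Exponents) : Measurable (integrandK n p) := by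
  unfold integrandK
  refine (((Finset.measurable_prod _ fun k _ => ?_).div (Finset.measurable_prod _ fun k _ => ?_)).mul
    ((Finset.measurable_prod _ fun k _ => measurable_deltaTilde k).div
      (Finset.measurable_prod _ fun k _ => measurable_deltaTilde k))).div (measurable_deltaTilde n)
  · exact ((measurable_coord k).pow_const _).mul ((measurable_const.sub (measurable_coord k)).pow_const _)
  · exact (measurable_deltaTilde k).pow_const _

/-! ### The pointwise identity -/

/-- **`F_𝒦(Y(X) ∘ rev) · W(X) = F_𝓛(P)(X)` on the open cube** (`n ≥ 2`): the integrand of `𝒦(p)` at the substituted point times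
the Jacobian weight is the integrand of `𝓛(P)`, `P = paramMap n p`.
[cite: Fischler2002Polyzetas, §2 Théorème 2.1] [cite: Fischler2003RhinViola, §5 (proof of Théorème 2.1)] -/
theorem integrandK_subst {n : ℕ} (hn : 2 ≤ n) (p : Exponents) {X : Fin n → ℝ} (hX : ∀ i, 0 < X i ∧ X i < 1) :
    integrandK n p (fun t : Fin n => (fun i : Fin n => if Even (i.1 + 1) then
        (1 - headProduct X i.1) * X i / (1 - headProduct X (i.1 + 1)) else X i) (Fin.rev t)) *
      (∏ j ∈ Finset.Icc 1 n, if Even j then (1 - headProduct X (j - 1)) / (1 - headProduct X j) ^ 2 else (1:ℝ)) =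
      integrandL n (paramMap n p) X := by
  -- notation-free abbreviations
  set Y : Fin n → ℝ := fun i : Fin n => if Even (i.1 + 1) then
      (1 - headProduct X i.1) * X i / (1 - headProduct X (i.1 + 1)) else X i with hY
  set x : Fin n → ℝ := fun t => Y (Fin.rev t) with hx
  have hne : ∀ j, 1 ≤ j → 1 - headProduct X j ≠ 0 := one_sub_headProduct_ne_zero hX
  have hy : ∀ j, 1 ≤ j → j ≤ n →
      coord Y j = (if Even j then (1 - headProduct X (j - 1)) / (1 - headProduct X j) else 1) * coord X j :=
    fun j _ _ => by rw [hY]; exact coord_moebiusMap X j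
  have hcx : ∀ k, coord x k = coord Y (n + 1 - k) := fun k => coord_rev Y k
  -- the closed form `R_k` of `δ̃_k`
  have hR : ∀ k, k ≤ n → deltaTilde x k = ∏ i ∈ Finset.Icc 1 k, (1 - headProduct X i) ^ (if Even i then (-1 : ℤ) else 1) :=
    fun k hk => deltaTilde_subst hX hy hk
  have hRne : ∀ k, (∏ i ∈ Finset.Icc 1 k, (1 - headProduct X i) ^ (if Even i then (-1 : ℤ) else 1)) ≠ 0 := fun k =>
    Finset.prod_ne_zero_iff.mpr fun i hi => zpow_ne_zero _ (hne i (Finset.mem_Icc.1 hi).1)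
  have hRrec : ∀ k, (∏ i ∈ Finset.Icc 1 (k + 1), (1 - headProduct X i) ^ (if Even i then (-1 : ℤ) else 1)) =
      (∏ i ∈ Finset.Icc 1 k, (1 - headProduct X i) ^ (if Even i then (-1 : ℤ) else 1)) *
        (1 - headProduct X (k + 1)) ^ (if Even (k + 1) then (-1 : ℤ) else 1) :=
    fun k => Finset.prod_Icc_succ_top (by omega) _
  have hR0 : (∏ i ∈ Finset.Icc 1 0, (1 - headProduct X i) ^ (if Even i then (-1 : ℤ) else 1)) = 1 := by
    rw [show (Finset.Icc 1 0 : Finset ℕ) = ∅ by decide, Finset.prod_empty]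
  -- (1) numerator: reflect `k ↦ n+1−k`, then substitute
  have hNum : (∏ k ∈ Finset.Icc 1 n, coord x k ^ p.a k * (1 - coord x k) ^ p.b k) =
      (∏ j ∈ Finset.Icc 1 n, coord X j ^ p.a (n + 1 - j) * (1 - coord X j) ^ p.b (n + 1 - j)) *
        ∏ i ∈ Finset.Icc 1 n, (1 - headProduct X i) ^
          ((if Even (i + 1) ∧ i + 1 ≤ n then p.a (n + 1 - (i + 1)) else 0) -
            (if Even i then p.a (n + 1 - i) + p.b (n + 1 - i) else 0)) := by
    have h1 : (∏ k ∈ Finset.Icc 1 n, coord x k ^ p.a k * (1 - coord x k) ^ p.b k) =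
        ∏ j ∈ Finset.Icc 1 n, coord Y j ^ p.a (n + 1 - j) * (1 - coord Y j) ^ p.b (n + 1 - j) := by
      refine prod_Icc_reflect fun k hk => ?_
      rw [hcx k, show n + 1 - (n + 1 - k) = k by have := (Finset.mem_Icc.1 hk).2; omega]
    rw [h1]
    have h2 := numerator_subst (coord X) (coord Y) (headProduct X) (fun j => p.a (n + 1 - j)) (fun j => p.b (n + 1 - j))
      (n := n) (by omega) (headProduct_succ X) hne hy
    beta_reduce at h2
    exact h2
  -- (2) the `δ̃_k^{c_k}`
  have hDen : (∏ k ∈ Finset.Icc 2 n, deltaTilde x k ^ p.c k) =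
      ∏ i ∈ Finset.Icc 1 n, (1 - headProduct X i) ^ ((if Even i then (-1 : ℤ) else 1) * ∑ k ∈ Finset.Icc (max i 2) n, p.c k) := by
    rw [Finset.prod_congr rfl fun k hk => by rw [hR k (Finset.mem_Icc.1 hk).2]]
    exact prod_closedForm_zpow (headProduct X) p.c n hne
  -- (3) the parity products times the Jacobian
  obtain ⟨m, rfl⟩ : ∃ m, n = m + 2 := ⟨n - 2, by omega⟩
  have hE : (∏ k ∈ Finset.Icc 1 m, if Even k then deltaTilde x k else (1:ℝ)) =
      ∏ k ∈ Finset.Icc 1 m, if Even k then (∏ i ∈ Finset.Icc 1 k, (1 - headProduct X i) ^ (if Even i then (-1 : ℤ) else 1))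
        else (1:ℝ) :=
    Finset.prod_congr rfl fun k hk => by rw [hR k (by have := (Finset.mem_Icc.1 hk).2; omega)]
  have hO : (∏ k ∈ Finset.Icc 2 (m + 1), if Odd k then deltaTilde x k else (1:ℝ)) =
      ∏ k ∈ Finset.Icc 2 (m + 1), if Odd k then (∏ i ∈ Finset.Icc 1 k, (1 - headProduct X i) ^ (if Even i then (-1 : ℤ) else 1))
        else (1:ℝ) :=
    Finset.prod_congr rfl fun k hk => by rw [hR k (by have := (Finset.mem_Icc.1 hk).2; omega)]
  have hPJ : (∏ k ∈ (Finset.Icc 2 (m + 2 - 2)).filter Even, deltaTilde x k) /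
        (∏ k ∈ (Finset.Icc 3 (m + 2 - 1)).filter Odd, deltaTilde x k) / deltaTilde x (m + 2) *
        (∏ j ∈ Finset.Icc 1 (m + 2), if Even j then (1 - headProduct X (j - 1)) / (1 - headProduct X j) ^ 2 else (1:ℝ)) =
      ∏ k ∈ Finset.Icc 2 (m + 2), (1 - headProduct X k) ^ (-1 : ℤ) := by
    rw [prod_filter_even_eq _ (by omega : 2 ≤ m + 2), prod_filter_odd_eq _ (by omega : 2 ≤ m + 2),
      show m + 2 - 2 = m from Nat.add_sub_cancel m 2, show m + 2 - 1 = m + 1 by omega, hR (m + 2) le_rfl, hE, hO]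
    exact parity_jacobian (headProduct X) (fun k => ∏ i ∈ Finset.Icc 1 k, (1 - headProduct X i) ^ (if Even i then (-1 : ℤ) else 1))
      hne hR0 hRrec hRne m
  -- (4) the `𝓛` side
  have hNumL : (∏ k ∈ Finset.Icc 1 (m + 2), coord X k ^ (paramMap (m + 2) p).a k * (1 - coord X k) ^ (paramMap (m + 2) p).b k) =
      (∏ j ∈ Finset.Icc 1 (m + 2), coord X j ^ p.a (m + 2 + 1 - j) * (1 - coord X j) ^ p.b (m + 2 + 1 - j)) *
        (1 - headProduct X 1) ^ ((paramMap (m + 2) p).b 1 - p.b (m + 2 + 1 - 1)) := by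
    have hs : (Finset.Icc 1 (m + 2) : Finset ℕ) = insert 1 (Finset.Icc 2 (m + 2)) := by
      ext k; simp only [Finset.mem_insert, Finset.mem_Icc]; omega
    have hP1 : headProduct X 1 = coord X 1 := by rw [show (1:ℕ) = 0 + 1 from rfl, headProduct_succ, headProduct_zero, one_mul]
    rw [hs, Finset.prod_insert (by simp), Finset.prod_insert (by simp), hP1]
    have h2 : ∀ k ∈ Finset.Icc 2 (m + 2), coord X k ^ (paramMap (m + 2) p).a k * (1 - coord X k) ^ (paramMap (m + 2) p).b k =
        coord X k ^ p.a (m + 2 + 1 - k) * (1 - coord X k) ^ p.b (m + 2 + 1 - k) := by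
      intro k hk
      simp only [paramMap, if_neg (show k ≠ 1 by have := (Finset.mem_Icc.1 hk).1; omega)]
    rw [Finset.prod_congr rfl h2]
    have hc1 : 1 - coord X 1 ≠ 0 := by rw [← hP1]; exact hne 1 le_rfl
    have ha : (paramMap (m + 2) p).a 1 = p.a (m + 2 + 1 - 1) := rfl
    rw [ha, zpow_sub₀ hc1]
    have hb : (1 - coord X 1) ^ p.b (m + 2 + 1 - 1) ≠ 0 := zpow_ne_zero _ hc1
    field_simp
  have hDenL : (∏ k ∈ Finset.Icc 2 (m + 2), (1 - headProduct X k) ^ ((paramMap (m + 2) p).c k + 1)) =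
      (∏ k ∈ Finset.Icc 2 (m + 2), (1 - headProduct X k) ^ (paramMap (m + 2) p).c k) *
        ∏ k ∈ Finset.Icc 2 (m + 2), (1 - headProduct X k) := by
    rw [← Finset.prod_mul_distrib]
    exact Finset.prod_congr rfl fun k hk => zpow_add_one₀ (hne k (by have := (Finset.mem_Icc.1 hk).1; omega)) _
  -- (5) the exponents of `1 − Π_i` match
  have hEXP : (∏ i ∈ Finset.Icc 1 (m + 2), (1 - headProduct X i) ^
        ((if Even (i + 1) ∧ i + 1 ≤ m + 2 then p.a (m + 2 + 1 - (i + 1)) else 0) -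
          (if Even i then p.a (m + 2 + 1 - i) + p.b (m + 2 + 1 - i) else 0))) =
      (∏ i ∈ Finset.Icc 1 (m + 2), (1 - headProduct X i) ^
          ((if Even i then (-1 : ℤ) else 1) * ∑ k ∈ Finset.Icc (max i 2) (m + 2), p.c k)) *
        ((1 - headProduct X 1) ^ ((paramMap (m + 2) p).b 1 - p.b (m + 2 + 1 - 1)) *
          (∏ k ∈ Finset.Icc 2 (m + 2), (1 - headProduct X k) ^ (paramMap (m + 2) p).c k)⁻¹) := by
    have hs : (Finset.Icc 1 (m + 2) : Finset ℕ) = insert 1 (Finset.Icc 2 (m + 2)) := by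
      ext k; simp only [Finset.mem_insert, Finset.mem_Icc]; omega
    have hsplit : ∀ i ∈ Finset.Icc 1 (m + 2), (1 - headProduct X i) ^
        ((if Even (i + 1) ∧ i + 1 ≤ m + 2 then p.a (m + 2 + 1 - (i + 1)) else 0) -
          (if Even i then p.a (m + 2 + 1 - i) + p.b (m + 2 + 1 - i) else 0)) =
        (1 - headProduct X i) ^ ((if Even i then (-1 : ℤ) else 1) * ∑ k ∈ Finset.Icc (max i 2) (m + 2), p.c k) *
          (1 - headProduct X i) ^ (if i = 1 then (paramMap (m + 2) p).b 1 - p.b (m + 2 + 1 - 1)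
            else -((paramMap (m + 2) p).c i)) := by
      intro i hi
      rw [← zpow_add₀ (hne i (Finset.mem_Icc.1 hi).1), ← exponent_identity (by omega) p hi]
      congr 1
      ring
    rw [Finset.prod_congr rfl hsplit, Finset.prod_mul_distrib]
    congr 1
    rw [hs, Finset.prod_insert (by simp), if_pos rfl, ← Finset.prod_inv_distrib]
    congr 1
    exact Finset.prod_congr rfl fun k hk => by
      rw [if_neg (show k ≠ 1 by have := (Finset.mem_Icc.1 hk).1; omega), zpow_neg]
  have hT : ∏ k ∈ Finset.Icc 2 (m + 2), (1 - headProduct X k) ^ (-1 : ℤ) = (∏ k ∈ Finset.Icc 2 (m + 2), (1 - headProduct X k))⁻¹ := by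
    rw [← Finset.prod_inv_distrib]
    exact Finset.prod_congr rfl fun k _ => zpow_neg_one _
  -- nonvanishing of the blocks
  have hDenK_ne : (∏ i ∈ Finset.Icc 1 (m + 2), (1 - headProduct X i) ^
      ((if Even i then (-1 : ℤ) else 1) * ∑ k ∈ Finset.Icc (max i 2) (m + 2), p.c k)) ≠ 0 :=
    Finset.prod_ne_zero_iff.mpr fun i hi => zpow_ne_zero _ (hne i (Finset.mem_Icc.1 hi).1)
  have hDC_ne : (∏ k ∈ Finset.Icc 2 (m + 2), (1 - headProduct X k) ^ (paramMap (m + 2) p).c k) ≠ 0 :=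
    Finset.prod_ne_zero_iff.mpr fun k hk => zpow_ne_zero _ (hne k (by have := (Finset.mem_Icc.1 hk).1; omega))
  have hDT_ne : (∏ k ∈ Finset.Icc 2 (m + 2), (1 - headProduct X k)) ≠ 0 :=
    Finset.prod_ne_zero_iff.mpr fun k hk => hne k (by have := (Finset.mem_Icc.1 hk).1; omega)
  -- assemble
  have hK : integrandK (m + 2) p x *
      (∏ j ∈ Finset.Icc 1 (m + 2), if Even j then (1 - headProduct X (j - 1)) / (1 - headProduct X j) ^ 2 else (1:ℝ)) =
      (∏ k ∈ Finset.Icc 1 (m + 2), coord x k ^ p.a k * (1 - coord x k) ^ p.b k) /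
        (∏ k ∈ Finset.Icc 2 (m + 2), deltaTilde x k ^ p.c k) *
        ((∏ k ∈ (Finset.Icc 2 (m + 2 - 2)).filter Even, deltaTilde x k) /
          (∏ k ∈ (Finset.Icc 3 (m + 2 - 1)).filter Odd, deltaTilde x k) / deltaTilde x (m + 2) *
          (∏ j ∈ Finset.Icc 1 (m + 2), if Even j then (1 - headProduct X (j - 1)) / (1 - headProduct X j) ^ 2 else (1:ℝ))) := by
    unfold integrandK
    ring
  rw [hK, hPJ, hNum, hDen, hEXP, hT]
  unfold integrandL
  rw [hNumL, hDenL]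
  field_simp

end KL

open KL JnChi JnPsi in
/-- **Fischler's Théorème 2.1 holds** (the named fact `theoreme21` of `BeukersSorokinChangeOfVariables.lean` is a theorem): for
every `n ≥ 2` and every `p ∈ ℤ^{3n−1}`, `𝒦(p) = 𝓛(P)` in `ℝ₊ ∪ {∞}` with `P = paramMap n p` — by the printed change of variables,
realised dimension-free: the cube reversal (`KL.lintegral_cube_rev`), the triangular Möbius substitution theorem
(`KL.lintegral_cube_eq_lintegral_moebius`, induction on `n`, no `n×n` Jacobian) and the pointwise identity `KL.integrandK_subst`.
[cite: Fischler2002Polyzetas, §2 Théorème 2.1] [cite: Fischler2003RhinViola, §5] -/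
theorem theoreme21_holds : theoreme21 := by
  intro n p hn
  unfold K L
  rw [← setLIntegral_congr (openCube_ae_eq_unitCube n), ← setLIntegral_congr (openCube_ae_eq_unitCube n),
    lintegral_cube_rev n (fun x => ENNReal.ofReal (integrandK n p x))]
  have hmeas : Measurable fun y : Fin n → ℝ => ENNReal.ofReal (integrandK n p (fun i => y (Fin.rev i))) :=
    ((measurable_integrandK n p).comp (measurable_pi_lambda _ fun i => measurable_pi_apply _)).ennreal_ofReal
  rw [lintegral_cube_eq_lintegral_moebius n _ hmeas]
  refine setLIntegral_congr_fun (measurableSet_openCube n) fun X hX' => ?_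
  have hX : ∀ i, 0 < X i ∧ X i < 1 := fun i => hX' i (Set.mem_univ _)
  dsimp only
  rw [← ENNReal.ofReal_mul' (weight_pos hX).le, integrandK_subst hn p hX]

end Literature.NumberTheory.Irrationality.Fischler2002

end
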